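import Mathlib.GroupTheory.Nilpotent
import Mathlib.GroupTheory.PGroup
import Mathlib.GroupTheory.FiniteAbelian.Basic
import Mathlib.Data.ZMod.Basic
import Mathlib.Data.Sigma.Order
import Mathlib.Data.Fintype.Sigma
import Literature.Barriers.MatrixMultiplication.NilpotentGroupBarrierPWords
import HarnessLib

/-!
# A `p`-central generating system for finite `p`-groups of bounded class and exponent

Topic `Literature/Barriers/MatrixMultiplication`; sixth file attached to the catalogue entry
`NilpotentGroupBarrier.lean` (towards the discharge of `BCCGU2017_cor320`,
Blasiak–Church–Cohn–Grochow–Umans 2017, Cor. 3.20): the group theory feeding the word calculus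
of `NilpotentGroupBarrierPWords.lean` — the construction of a `PCGS p S ι` (Def. 3.5 of BCCGU
abstracted: a central series with elementary abelian factors and lifts of bases of the factors)
for every finite `p`-group `S` of nilpotency class `≤ c` and exponent dividing `p^e`, with
`L = c·e` levels (`exists_pcgs`). BCCGU use the `p`-lower central (Jennings) series
`Γ_i = [G, Γ_{i-1}] Γ_{⌈i/p⌉}^{(p)}` and remark that its length is `≤ mc` for exponent `m` and
class `c` (proof of Cor. 3.20, held text p. 8); any central series with elementary abelian
factors and boundedly many levels serves our purpose, and we take the simplest one.

Source: J. Blasiak, T. Church, H. Cohn, J. A. Grochow, C. Umans, *Which groups are amenable to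
proving exponent two for matrix multiplication?*, arXiv:1712.02302
[BlasiakChurchCohnGrochowUmans2017], Def. 3.5, Prop. 3.10 (proof: "choose `g_{j,i} ∈ Γ_j`
descending to a basis for `Γ_j/Γ_{j+1}`"), proof of Cor. 3.20 (held text pp. 6–8).

## Content (all proved)

* `refLCS p S k i = ⟨x^{p^i} : x ∈ γ_k⟩^S · γ_{k+1}` — the lower central series `γ_k` of `S`
  refined by `p^i`-th powers; `refLCS_zero`, `refLCS_succ_le`, `commutator_refLCS_le`
  (`⁅P_{k,i}, S⁆ ≤ γ_{k+1}`), `pow_p_mem_refLCS_succ` (`y ∈ P_{k,i} ⟹ y^p ∈ P_{k,i+1}`, computed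
  in the abelian quotient `γ_k/γ_{k+1}`), `refLCS_of_exponent_dvd` (`P_{k,e} = γ_{k+1}`).
* `levelH p S e s = P_{s/e, s%e}`: a descending central series `S = H_0 ≥ ⋯ ≥ H_{ce} = 1`
  (`levelH_zero`, `levelH_succ_le`, `commutator_levelH_le`, `pow_p_mem_levelH_succ`,
  `levelH_eq_bot`).
* `exists_level_gens`: for `B ≤ A ≤ S`, `B ◁ S`, `⁅A,A⁆ ≤ B`, `A^p ⊆ B`, generators
  `g_0,…,g_{r-1} ∈ A` with `|A| = p^r |B|` and `x ∈ (∏ⱼ g_j^{m_j}) B` (`m_j < p`) for every `x ∈ A`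
  and every order of the factors (the structure theorem for the finite abelian group `A/B` of
  exponent `p`, `CommGroup.equiv_prod_multiplicative_zmod_of_finite`).
* `exists_pcgs`: the alphabet `Σₗ s, Fin (r s)` (lexicographic), generators = the lifts, normal
  forms by descending induction on the level (`prod_map_split`: an ordered product over a sorted
  alphabet splits along a monotone level function), commutator and power exponent vectors from the
  normal forms in the next level, `|S| = p^{Σ r_s}` by the chain of indices.
-/

noncomputable section

open scoped BigOperators commutatorElement Pointwise
open Finset

namespace Literature.Barriers.MatrixMultiplication

universe u

/-! ## The refined lower central series -/

section Series

variable (p : ℕ) (S : Type u) [Group S]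

/-- `γ_k(S)`, the lower central series (`γ_0 = S`, `γ_{k+1} = ⁅γ_k, S⁆`). [folklore] -/
abbrev lcs (k : ℕ) : Subgroup S := (⊤ : Subgroup S).lowerCentralSeries k

/-- The generating set `{x^{p^i} : x ∈ γ_k}`. [folklore] -/
def powSet (k i : ℕ) : Set S := (fun x : S => x ^ p ^ i) '' (lcs S k : Set S)

/-- **The refined lower central series** `P_{k,i} = ⟨x^{p^i} : x ∈ γ_k⟩ · γ_{k+1}`
(`P_{k,0} = γ_k`, `P_{k,e} = γ_{k+1}` when the exponent divides `p^e`): a central series of `S`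
with elementary abelian factors refining the lower central series.
[cite: BlasiakChurchCohnGrochowUmans2017, Def. 3.5] -/
def refLCS (k i : ℕ) : Subgroup S := Subgroup.normalClosure (powSet p S k i) ⊔ lcs S (k + 1)

variable {p S}

/-- `γ_{k+1} = ⁅γ_k, S⁆`. [folklore] -/
theorem lcs_succ (k : ℕ) : lcs S (k + 1) = ⁅lcs S k, (⊤ : Subgroup S)⁆ :=
  Subgroup.lowerCentralSeries_succ ⊤ k

/-- The lower central series decreases. [folklore] -/
theorem lcs_antitone : Antitone (lcs S) := Subgroup.lowerCentralSeries_antitone ⊤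

/-- The `γ_k` are normal. [folklore] -/
instance lcs_normal (k : ℕ) : (lcs S k).Normal := Subgroup.lowerCentralSeries_normal ⊤ k

/-- The `P_{k,i}` are normal. [folklore] -/
instance refLCS_normal (k i : ℕ) : (refLCS p S k i).Normal := by
  unfold refLCS; infer_instance

/-- `{x^{p^i} : x ∈ γ_k} ⊆ γ_k`. [folklore] -/
theorem powSet_subset_lcs (k i : ℕ) : powSet p S k i ⊆ (lcs S k : Set S) := by
  rintro _ ⟨x, hx, rfl⟩
  exact (lcs S k).pow_mem hx _

/-- `P_{k,i} ≤ γ_k`. [folklore] -/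
theorem refLCS_le_lcs (k i : ℕ) : refLCS p S k i ≤ lcs S k :=
  sup_le (Subgroup.normalClosure_le_normal (powSet_subset_lcs k i)) (lcs_antitone (Nat.le_succ k))

/-- `γ_{k+1} ≤ P_{k,i}`. [folklore] -/
theorem lcs_succ_le_refLCS (k i : ℕ) : lcs S (k + 1) ≤ refLCS p S k i := le_sup_right

/-- `x ∈ γ_k ⟹ x^{p^i} ∈ P_{k,i}`. [folklore] -/
theorem pow_mem_refLCS {k : ℕ} (i : ℕ) {x : S} (hx : x ∈ lcs S k) : x ^ p ^ i ∈ refLCS p S k i :=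
  le_sup_left (b := lcs S (k + 1)) (Subgroup.subset_normalClosure ⟨x, hx, rfl⟩)

/-- `γ_k ≤ P_{k,0}`. [folklore] -/
theorem lcs_le_refLCS_zero (k : ℕ) : lcs S k ≤ refLCS p S k 0 := fun x hx => by
  simpa using pow_mem_refLCS (p := p) 0 hx

/-- `P_{k,0} = γ_k`. [folklore] -/
theorem refLCS_zero (k : ℕ) : refLCS p S k 0 = lcs S k :=
  le_antisymm (refLCS_le_lcs k 0) (lcs_le_refLCS_zero k)

/-- `P_{k,i+1} ≤ P_{k,i}`. [folklore] -/
theorem refLCS_succ_le (k i : ℕ) : refLCS p S k (i + 1) ≤ refLCS p S k i := by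
  refine sup_le ?_ (lcs_succ_le_refLCS k i)
  refine Subgroup.normalClosure_le_normal ?_
  rintro _ ⟨x, hx, rfl⟩
  show x ^ p ^ (i + 1) ∈ refLCS p S k i
  rw [pow_succ', pow_mul]
  exact pow_mem_refLCS i ((lcs S k).pow_mem hx p)

/-- Central series: `⁅P_{k,i}, S⁆ ≤ γ_{k+1}`. [folklore] -/
theorem commutator_refLCS_le (k i : ℕ) : ⁅refLCS p S k i, (⊤ : Subgroup S)⁆ ≤ lcs S (k + 1) := by
  rw [lcs_succ]
  exact Subgroup.commutator_mono (refLCS_le_lcs k i) le_rfl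

/-- **`p`-th powers climb the refined series**: `y ∈ P_{k,i} ⟹ y^p ∈ P_{k,i+1}` (in
`γ_k/γ_{k+1}`, which is abelian, `(∏ xₗ^{±p^i})^p = ∏ xₗ^{±p^{i+1}}`).
[cite: BlasiakChurchCohnGrochowUmans2017, Def. 3.5] -/
theorem pow_p_mem_refLCS_succ {k i : ℕ} {y : S} (hy : y ∈ refLCS p S k i) :
    y ^ p ∈ refLCS p S k (i + 1) := by
  set N := lcs S (k + 1) with hN
  -- decompose `y = a * n`
  have hy' : y ∈ ((refLCS p S k i : Subgroup S) : Set S) := hy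
  rw [refLCS, Subgroup.mul_normal] at hy'
  obtain ⟨a, ha, n, hn, rfl⟩ := Set.mem_mul.1 hy'
  -- the claim for `a ∈ normalClosure (powSet)`: by closure induction
  have hclaim : ∀ a ∈ Subgroup.normalClosure (powSet p S k i),
      a ∈ lcs S k ∧ a ^ p ∈ refLCS p S k (i + 1) := by
    intro a ha
    rw [Subgroup.normalClosure] at ha
    induction ha using Subgroup.closure_induction with
    | mem x hx =>
      obtain ⟨z, hz, hzx⟩ := Group.mem_conjugatesOfSet_iff.1 hx
      obtain ⟨x₀, hx₀, rfl⟩ := hz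
      obtain ⟨c, rfl⟩ := isConj_iff.1 hzx
      have hc : c * x₀ * c⁻¹ ∈ lcs S k := (lcs_normal k).conj_mem _ hx₀ c
      rw [← conj_pow]
      refine ⟨(lcs S k).pow_mem hc _, ?_⟩
      rw [← pow_mul, ← pow_succ]
      exact pow_mem_refLCS (i + 1) hc
    | one => exact ⟨one_mem _, by rw [one_pow]; exact one_mem _⟩
    | mul x z _ _ hx hz =>
      refine ⟨mul_mem hx.1 hz.1, ?_⟩
      -- `x` and `z` commute modulo `N`
      have hcomm : ⁅z⁻¹, x⁻¹⁆ ∈ N := by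
        rw [hN, lcs_succ]
        exact Subgroup.commutator_mem_commutator (inv_mem hz.1) (Subgroup.mem_top _)
      have hq : (QuotientGroup.mk (x * z) : S ⧸ N) ^ p =
          (QuotientGroup.mk x : S ⧸ N) ^ p * (QuotientGroup.mk z : S ⧸ N) ^ p := by
        rw [QuotientGroup.mk_mul]
        refine (Commute.mul_pow ?_ p)
        show QuotientGroup.mk x * QuotientGroup.mk z = QuotientGroup.mk z * QuotientGroup.mk x
        rw [← QuotientGroup.mk_mul, ← QuotientGroup.mk_mul, QuotientGroup.eq]
        have : (x * z)⁻¹ * (z * x) = ⁅z⁻¹, x⁻¹⁆ := by rw [commutatorElement_def]; group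
        rw [this]; exact hcomm
      rw [← QuotientGroup.mk_pow, ← QuotientGroup.mk_pow, ← QuotientGroup.mk_pow,
        ← QuotientGroup.mk_mul, QuotientGroup.eq] at hq
      have : (x * z) ^ p = (x ^ p * z ^ p) * (((x * z) ^ p)⁻¹ * (x ^ p * z ^ p))⁻¹ := by group
      rw [this]
      exact mul_mem (mul_mem hx.2 hz.2) (inv_mem (lcs_succ_le_refLCS k (i + 1) hq))
    | inv x _ hx =>
      refine ⟨inv_mem hx.1, ?_⟩
      rw [inv_pow]
      exact inv_mem hx.2
  obtain ⟨haL, hap⟩ := hclaim a ha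
  -- `(a n)^p ∈ a^p N`
  have hq : ((QuotientGroup.mk (a * n) : S ⧸ N)) ^ p = (QuotientGroup.mk a : S ⧸ N) ^ p := by
    congr 1
    rw [QuotientGroup.mk_mul, (QuotientGroup.eq_one_iff n).2 hn, mul_one]
  rw [← QuotientGroup.mk_pow, ← QuotientGroup.mk_pow, eq_comm, QuotientGroup.eq] at hq
  have : (a * n) ^ p = a ^ p * ((a ^ p)⁻¹ * (a * n) ^ p) := by group
  rw [this]
  exact mul_mem hap (lcs_succ_le_refLCS k (i + 1) hq)

/-- If the exponent divides `p^e` then `P_{k,e} = γ_{k+1}`. [folklore] -/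
theorem refLCS_of_exponent_dvd {e : ℕ} (he : Monoid.exponent S ∣ p ^ e) (k : ℕ) :
    refLCS p S k e = lcs S (k + 1) := by
  refine le_antisymm (sup_le (Subgroup.normalClosure_le_normal ?_) le_rfl) (lcs_succ_le_refLCS k e)
  rintro _ ⟨x, -, rfl⟩
  have : x ^ p ^ e = 1 := by
    obtain ⟨m, hm⟩ := he
    rw [hm, pow_mul, Monoid.pow_exponent_eq_one, one_pow]
  simp [this]

end Series

/-! ## The levels `H_s = P_{s / e, s % e}` -/

section Levels

variable (p : ℕ) (S : Type u) [Group S] (e : ℕ)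

/-- The level subgroups: `H_s = P_{s/e, s%e}`, `s = 0, …, c·e`. [cite: BlasiakChurchCohnGrochowUmans2017, Def. 3.5] -/
def levelH (s : ℕ) : Subgroup S := refLCS p S (s / e) (s % e)

variable {p S e}

/-- The levels are normal. [folklore] -/
instance levelH_normal (s : ℕ) : (levelH p S e s).Normal := by unfold levelH; infer_instance

/-- Successor arithmetic of `(s / e, s % e)`. [folklore] -/
theorem succ_div_mod_cases (he : 0 < e) (s : ℕ) :
    ((s + 1) % e = 0 ∧ s % e + 1 = e ∧ (s + 1) / e = s / e + 1) ∨
      ((s + 1) % e = s % e + 1 ∧ (s + 1) / e = s / e) := by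
  have hlt : s % e < e := Nat.mod_lt _ he
  have hs : s % e + e * (s / e) = s := Nat.mod_add_div s e
  have hmod : (s + 1) % e = (s % e + 1) % e := by
    conv_lhs => rw [← hs, add_right_comm, Nat.add_mul_mod_self_left]
  rcases Nat.lt_or_ge (s % e + 1) e with h | h
  · right
    refine ⟨by rw [hmod, Nat.mod_eq_of_lt h], ?_⟩
    rw [Nat.succ_div, if_neg]
    · rfl
    · intro hd
      have := Nat.mod_eq_zero_of_dvd hd
      rw [hmod, Nat.mod_eq_of_lt h] at this
      omega
  · left
    have heq : s % e + 1 = e := by omega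
    refine ⟨by rw [hmod, heq, Nat.mod_self], heq, ?_⟩
    rw [Nat.succ_div, if_pos]
    refine Nat.dvd_of_mod_eq_zero ?_
    rw [hmod, heq, Nat.mod_self]

/-- `H_0 = S`. [folklore] -/
theorem levelH_zero : levelH p S e 0 = ⊤ := by
  unfold levelH
  rw [Nat.zero_div, Nat.zero_mod, refLCS_zero]
  rfl

/-- `H_s ≤ γ_{s/e}`. [folklore] -/
theorem levelH_le_lcs (s : ℕ) : levelH p S e s ≤ lcs S (s / e) := refLCS_le_lcs _ _

/-- `γ_{s/e+1} ≤ H_{s+1}`. [folklore] -/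
theorem lcs_succ_le_levelH_succ (he : 0 < e) (s : ℕ) : lcs S (s / e + 1) ≤ levelH p S e (s + 1) := by
  unfold levelH
  rcases succ_div_mod_cases he s with ⟨h0, -, h1⟩ | ⟨h0, h1⟩
  · rw [h1, h0]
    exact lcs_le_refLCS_zero _
  · rw [h1]
    exact lcs_succ_le_refLCS _ _

/-- The levels decrease. [folklore] -/
theorem levelH_succ_le (he : 0 < e) (s : ℕ) : levelH p S e (s + 1) ≤ levelH p S e s := by
  unfold levelH
  rcases succ_div_mod_cases he s with ⟨h0, -, h1⟩ | ⟨h0, h1⟩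
  · rw [h1, h0]
    exact (refLCS_le_lcs _ _).trans (lcs_succ_le_refLCS _ _)
  · rw [h1, h0]
    exact refLCS_succ_le _ _

/-- The levels decrease. [folklore] -/
theorem levelH_antitone (he : 0 < e) : Antitone (levelH p S e) :=
  antitone_nat_of_succ_le (levelH_succ_le he)

/-- Central: `⁅H_s, S⁆ ≤ H_{s+1}`. [folklore] -/
theorem commutator_levelH_le (he : 0 < e) (s : ℕ) :
    ⁅levelH p S e s, (⊤ : Subgroup S)⁆ ≤ levelH p S e (s + 1) :=
  (commutator_refLCS_le _ _).trans (lcs_succ_le_levelH_succ he s)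

/-- `p`-th powers: `y ∈ H_s ⟹ y^p ∈ H_{s+1}` (exponent dividing `p^e`). [folklore] -/
theorem pow_p_mem_levelH_succ (he : 0 < e) (hexp : Monoid.exponent S ∣ p ^ e) {s : ℕ} {y : S}
    (hy : y ∈ levelH p S e s) : y ^ p ∈ levelH p S e (s + 1) := by
  have h0 := pow_p_mem_refLCS_succ hy
  unfold levelH
  rcases succ_div_mod_cases he s with ⟨hm, h2, h1⟩ | ⟨hm, h1⟩
  · rw [h1, hm]
    rw [h2, refLCS_of_exponent_dvd hexp] at h0
    exact lcs_le_refLCS_zero _ h0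
  · rw [h1, hm]
    exact h0

/-- Termination: `H_{c e} = 1` when the class is `≤ c`. [folklore] -/
theorem levelH_eq_bot (he : 0 < e) {c : ℕ} [Group.IsNilpotent S] (hc : Group.nilpotencyClass S ≤ c) :
    levelH p S e (c * e) = ⊥ := by
  refine le_bot_iff.1 ((levelH_le_lcs _).trans ?_)
  rw [Nat.mul_div_cancel _ he]
  exact (Subgroup.lowerCentralSeries_eq_bot_iff_nilpotencyClass_le.2 hc).le

end Levels

/-! ## One level: bases of an elementary abelian central factor -/

section OneLevel

variable {p : ℕ} [hp : Fact p.Prime] {S : Type u} [Group S]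

/-- **A level of the series as an `𝔽_p`-vector space**: if `B ≤ A ≤ S`, `B ◁ S`, `⁅A, A⁆ ≤ B` and
`x^p ∈ B` for `x ∈ A` (`A` finite), there are `r` elements `g₀, …, g_{r-1} ∈ A` with
`|A| = p^r |B|` such that every `x ∈ A` is `∏ⱼ gⱼ^{mⱼ} · z` with `mⱼ < p`, `z ∈ B`, for ANY
order of the factors (lifts of a basis of the `𝔽_p`-vector space `A/B`).
[cite: BlasiakChurchCohnGrochowUmans2017, Prop. 3.10 (proof)] -/
theorem exists_level_gens (A B : Subgroup S) [B.Normal] [Finite A] (hBA : B ≤ A)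
    (hcomm : ⁅A, A⁆ ≤ B) (hpow : ∀ x ∈ A, x ^ p ∈ B) :
    ∃ (r : ℕ) (g : ℕ → S), (∀ j, g j ∈ A) ∧ Nat.card A = p ^ r * Nat.card B ∧
      ∀ x ∈ A, ∃ m : ℕ → ℕ, (∀ j, m j < p) ∧ ∀ l : List ℕ, l.Nodup → (∀ j, j ∈ l ↔ j < r) →
        ∃ z ∈ B, x = (l.map fun j => g j ^ m j).prod * z := by
  classical
  set N : Subgroup A := B.subgroupOf A with hN
  haveI hNn : N.Normal := Subgroup.normal_subgroupOf
  -- the quotient is abelian of exponent `p`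
  have hcomm' : ∀ a b : A, (QuotientGroup.mk a : A ⧸ N) * QuotientGroup.mk b =
      QuotientGroup.mk b * QuotientGroup.mk a := by
    intro a b
    rw [← QuotientGroup.mk_mul, ← QuotientGroup.mk_mul, QuotientGroup.eq, hN, Subgroup.mem_subgroupOf]
    have : (((a * b)⁻¹ * (b * a) : A) : S) = ⁅((b : A) : S)⁻¹, ((a : A) : S)⁻¹⁆ := by
      rw [commutatorElement_def]; push_cast; group
    rw [this]
    exact hcomm (Subgroup.commutator_mem_commutator (inv_mem b.2) (inv_mem a.2))
  letI iCG : CommGroup (A ⧸ N) :=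
    { (inferInstance : Group (A ⧸ N)) with
      mul_comm := fun a b => by
        induction a using QuotientGroup.induction_on
        induction b using QuotientGroup.induction_on
        exact hcomm' _ _ }
  have hexp : ∀ q : A ⧸ N, q ^ p = 1 := by
    intro q
    induction q using QuotientGroup.induction_on with
    | H a =>
      rw [← QuotientGroup.mk_pow, QuotientGroup.eq_one_iff, hN, Subgroup.mem_subgroupOf]
      exact hpow _ a.2
  haveI : NeZero p := ⟨hp.out.ne_zero⟩
  -- structure of the finite abelian group `A ⧸ N`: a product of cyclic groups, all of order `p`
  obtain ⟨ι0, instι, n, hn1, ⟨eQ⟩⟩ := CommGroup.equiv_prod_multiplicative_zmod_of_finite (A ⧸ N)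
  have hnp : ∀ i, n i = p := by
    intro i
    haveI : NeZero (n i) := ⟨by have := hn1 i; omega⟩
    have h1 : (Pi.mulSingle i (Multiplicative.ofAdd (1 : ZMod (n i))) :
        ∀ i, Multiplicative (ZMod (n i))) ^ p = 1 := by
      rw [← eQ.apply_symm_apply (Pi.mulSingle i _), ← map_pow, hexp, map_one]
    have h2 := congr_fun h1 i
    rw [Pi.pow_apply, Pi.mulSingle_eq_same, Pi.one_apply, ← ofAdd_nsmul, Nat.smul_one_eq_cast,
      ← ofAdd_zero, Multiplicative.ofAdd.apply_eq_iff_eq, ZMod.natCast_eq_zero_iff] at h2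
    rcases (Nat.dvd_prime hp.out).1 h2 with h | h
    · exact absurd h (by have := hn1 i; omega)
    · exact h
  haveI : ∀ i, NeZero (n i) := fun i => ⟨by rw [hnp i]; exact hp.out.ne_zero⟩
  set r := Fintype.card ι0 with hr
  set σ := Fintype.equivFin ι0 with hσ
  -- the generators: lifts of the coordinate vectors
  let b : ι0 → A ⧸ N := fun i => eQ.symm (Pi.mulSingle i (Multiplicative.ofAdd 1))
  let g' : ℕ → A := fun j => if h : j < r then Quotient.out (b (σ.symm ⟨j, h⟩)) else 1
  have hg' : ∀ j (h : j < r), (QuotientGroup.mk (g' j) : A ⧸ N) = b (σ.symm ⟨j, h⟩) := by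
    intro j h
    simp only [g', dif_pos h]
    exact QuotientGroup.out_eq' _
  refine ⟨r, fun j => (g' j : S), fun j => (g' j).2, ?_, ?_⟩
  · -- cardinality
    rw [Subgroup.card_eq_card_quotient_mul_card_subgroup N,
      Nat.card_congr (Subgroup.subgroupOfEquivOfLe hBA).toEquiv]
    congr 1
    rw [Nat.card_congr eQ.toEquiv, Nat.card_pi]
    simp only [Nat.card_eq_fintype_card, Fintype.card_multiplicative, ZMod.card, hnp,
      Finset.prod_const, Finset.card_univ, hr]
  · -- normal forms
    intro x hx
    set q : A ⧸ N := QuotientGroup.mk ⟨x, hx⟩ with hq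
    set v := eQ q with hv
    let m : ℕ → ℕ := fun j => if h : j < r then (Multiplicative.toAdd (v (σ.symm ⟨j, h⟩))).val else 0
    have hm : ∀ j, m j < p := by
      intro j
      simp only [m]
      split_ifs with h
      · rw [← hnp (σ.symm ⟨j, h⟩)]; exact ZMod.val_lt _
      · exact hp.out.pos
    refine ⟨m, hm, fun l hl hmem => ?_⟩
    set y' : A := (l.map fun j => g' j ^ m j).prod with hy'
    -- `mk y' = q`
    have hprod : (QuotientGroup.mk y' : A ⧸ N) = q := by
      have h1 : (QuotientGroup.mk y' : A ⧸ N) =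
          (l.map fun j => (QuotientGroup.mk (g' j) : A ⧸ N) ^ m j).prod := by
        rw [hy', ← QuotientGroup.mk'_apply, map_list_prod, List.map_map]
        rfl
      set F : ℕ → A ⧸ N := fun j =>
        if h : j < r then b (σ.symm ⟨j, h⟩) ^ (Multiplicative.toAdd (v (σ.symm ⟨j, h⟩))).val else 1
        with hF
      have h2 : (l.map fun j => (QuotientGroup.mk (g' j) : A ⧸ N) ^ m j) = l.map F := by
        refine List.map_congr_left fun j hj => ?_
        have hjr : j < r := (hmem j).1 hj
        simp only [hF, m, dif_pos hjr, hg' j hjr]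
      have h3 : (l.map F).prod = ∏ j ∈ Finset.range r, F j := by
        rw [← List.prod_toFinset F hl]
        congr 1
        ext j
        rw [List.mem_toFinset, Finset.mem_range, hmem]
      have h4 : ∏ j ∈ Finset.range r, F j =
          ∏ j : Fin r, b (σ.symm j) ^ (Multiplicative.toAdd (v (σ.symm j))).val := by
        rw [← Fin.prod_univ_eq_prod_range]
        refine Finset.prod_congr rfl fun j _ => ?_
        simp only [hF, dif_pos j.2, Fin.eta]
      have h5 : ∏ j : Fin r, b (σ.symm j) ^ (Multiplicative.toAdd (v (σ.symm j))).val =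
          ∏ i : ι0, b i ^ (Multiplicative.toAdd (v i)).val :=
        Fintype.prod_equiv σ.symm _ _ fun _ => rfl
      have h6 : ∏ i : ι0, b i ^ (Multiplicative.toAdd (v i)).val = eQ.symm v := by
        simp only [b, ← map_pow, ← map_prod]
        congr 1
        conv_rhs => rw [← Finset.univ_prod_mulSingle v]
        refine Finset.prod_congr rfl fun i _ => ?_
        rw [← Pi.mulSingle_pow, ← ofAdd_nsmul, Nat.smul_one_eq_cast, ZMod.natCast_zmod_val,
          ofAdd_toAdd]
      rw [h1, h2, h3, h4, h5, h6, hv, eQ.symm_apply_apply]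
    rw [hq, QuotientGroup.eq, hN, Subgroup.mem_subgroupOf] at hprod
    refine ⟨(y' : S)⁻¹ * x, by simpa using hprod, ?_⟩
    -- identify the coercion of the product
    have hcoe : (l.map fun j => (g' j : S) ^ m j).prod = (y' : S) := by
      rw [hy', ← Subgroup.coe_subtype, map_list_prod, List.map_map]
      rfl
    rw [hcoe, mul_inv_cancel_left]

end OneLevel

/-! ## Assembly of the `p`-central generating system -/

section Assembly

/-- Three-way split of an ordered product along a monotone level function. [folklore] -/
theorem prod_map_split {ι M : Type*} [LinearOrder ι] [Monoid M] (f : ι → ℕ) (hf : Monotone f)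
    (g : ι → M) (s : ℕ) : ∀ l : List ι, l.Pairwise (· ≤ ·) →
      (l.map g).prod = ((l.filter fun a => f a < s).map g).prod *
        ((l.filter fun a => f a = s).map g).prod * ((l.filter fun a => s < f a).map g).prod := by
  intro l
  induction l with
  | nil => intro; simp
  | cons a l ih =>
    intro hl
    rw [List.pairwise_cons] at hl
    have ih' := ih hl.2
    -- no element of `l` is below `a`
    have hge : ∀ b ∈ l, f a ≤ f b := fun b hb => hf (hl.1 b hb)
    rcases Nat.lt_trichotomy (f a) s with h | h | h
    · rw [List.filter_cons_of_pos (by simpa using h), List.filter_cons_of_neg (by simp; omega),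
        List.filter_cons_of_neg (by simp; omega), List.map_cons, List.prod_cons, List.map_cons,
        List.prod_cons, ih', mul_assoc, mul_assoc, mul_assoc]
    · have h3 : (l.filter fun b => f b < s) = [] := by
        rw [List.filter_eq_nil_iff]
        intro b hb
        have := hge b hb
        simp only [decide_eq_true_eq, not_lt]; omega
      rw [List.filter_cons_of_neg (by simp; omega), List.filter_cons_of_pos (by simpa using h),
        List.filter_cons_of_neg (by simp; omega), List.map_cons, List.prod_cons, List.map_cons,
        List.prod_cons, ih', h3, List.map_nil, List.prod_nil, one_mul, one_mul, mul_assoc]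
    · have h3 : (l.filter fun b => f b < s) = [] := by
        rw [List.filter_eq_nil_iff]
        intro b hb
        have := hge b hb
        simp only [decide_eq_true_eq, not_lt]; omega
      have h4 : (l.filter fun b => f b = s) = [] := by
        rw [List.filter_eq_nil_iff]
        intro b hb
        have := hge b hb
        simp only [decide_eq_true_eq]; omega
      rw [List.filter_cons_of_neg (by simp; omega), List.filter_cons_of_neg (by simp; omega),
        List.filter_cons_of_pos (by simpa using h), List.map_cons, List.prod_cons, List.map_cons,
        List.prod_cons, ih', h3, h4, List.map_nil, List.prod_nil, one_mul, one_mul, one_mul]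

/-- A product of trivial powers is trivial. [folklore] -/
theorem prod_map_pow_eq_one {ι M : Type*} [Monoid M] (g : ι → M) (e : ι → ℕ) (l : List ι)
    (h : ∀ a ∈ l, e a = 0) : (l.map fun a => g a ^ e a).prod = 1 := by
  apply List.prod_eq_one
  intro x hx
  obtain ⟨a, ha, rfl⟩ := List.mem_map.1 hx
  rw [h a ha, pow_zero]

variable {p : ℕ} [hp : Fact p.Prime] {S : Type u} [Group S] [Finite S]

/-- **Existence of a `p`-central generating system** for a finite `p`-group of nilpotency class
`≤ c` and exponent dividing `p^e` (`e ≥ 1`), with `c·e` levels: lift bases of the elementary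
abelian factors of the refined lower central series `(P_{k,i})`.
[cite: BlasiakChurchCohnGrochowUmans2017, Def. 3.5 and Prop. 3.10] -/
theorem exists_pcgs [Group.IsNilpotent S] {c e : ℕ} (he : 0 < e)
    (hc : Group.nilpotencyClass S ≤ c) (hexp : Monoid.exponent S ∣ p ^ e) :
    ∃ (ι : Type) (_ : LinearOrder ι) (_ : Fintype ι) (C : PCGS p S ι), C.L = c * e := by
  classical
  set L := c * e with hL
  set H : ℕ → Subgroup S := levelH p S e with hH
  have Hanti : Antitone H := levelH_antitone he
  have HL : H L = ⊥ := levelH_eq_bot he hc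
  have H0 : H 0 = ⊤ := levelH_zero
  have Hcomm : ∀ s, ⁅H s, (⊤ : Subgroup S)⁆ ≤ H (s + 1) := commutator_levelH_le he
  have Hpow : ∀ s, ∀ y ∈ H s, y ^ p ∈ H (s + 1) := fun s y hy => pow_p_mem_levelH_succ he hexp hy
  -- per-level generators
  have hlev : ∀ s : Fin L, ∃ (r : ℕ) (g : ℕ → S), (∀ j, g j ∈ H s) ∧
      Nat.card (H s) = p ^ r * Nat.card (H (s + 1)) ∧
      ∀ x ∈ H s, ∃ m : ℕ → ℕ, (∀ j, m j < p) ∧ ∀ l : List ℕ, l.Nodup → (∀ j, j ∈ l ↔ j < r) →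
        ∃ z ∈ H (s + 1), x = (l.map fun j => g j ^ m j).prod * z := by
    intro s
    haveI : (H (s + 1)).Normal := by rw [hH]; infer_instance
    exact exists_level_gens (H s) (H (s + 1)) (Hanti (Nat.le_succ _))
      ((Subgroup.commutator_mono le_rfl le_top).trans (Hcomm s)) (Hpow s)
  choose r g hgH hcard hrepr using hlev
  -- the alphabet
  let ι := Lex (Σ s : Fin L, Fin (r s))
  let lvl : ι → ℕ := fun a => ((ofLex a).1 : ℕ)
  let gen : ι → S := fun a => g (ofLex a).1 (ofLex a).2
  have lvl_mono : Monotone lvl := by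
    intro a b hab
    rcases (Sigma.Lex.le_def.1 hab) with h | ⟨h, -⟩
    · exact (Fin.lt_def.1 h).le
    · exact (Fin.ext_iff.1 h).le
  have lvl_lt : ∀ a, lvl a < L := fun a => (ofLex a).1.2
  have gen_mem : ∀ a, gen a ∈ H (lvl a) := fun a => hgH _ _
  -- normal forms, by descending induction on the level
  have hrep : ∀ d s, s + d = L → ∀ x ∈ H s, ∃ ex : ι → ℕ, (∀ a, ex a < p) ∧
      (∀ a, lvl a < s → ex a = 0) ∧ x = orderedProd gen ex := by
    intro d
    induction d with
    | zero =>
      intro s hs x hx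
      rw [Nat.add_zero] at hs
      subst hs
      rw [HL, Subgroup.mem_bot] at hx
      subst hx
      refine ⟨fun _ => 0, fun _ => hp.out.pos, fun _ _ => rfl, ?_⟩
      rw [orderedProd, prod_map_pow_eq_one _ _ _ (fun _ _ => rfl)]
    | succ d ih =>
      intro s hs x hx
      have hsL : s < L := by omega
      set s' : Fin L := ⟨s, hsL⟩ with hs'
      obtain ⟨m, hm, hml⟩ := hrepr s' x hx
      -- the level-`s` letters, in alphabet order
      set F := (Finset.univ : Finset ι).sort (· ≤ ·) with hF
      set l : List ℕ := (F.filter fun a => lvl a = s).map fun a => ((ofLex a).2 : ℕ) with hl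
      have hlnodup : l.Nodup := by
        refine List.Nodup.map_on ?_ ((Finset.sort_nodup _ _).filter _)
        intro a ha b hb hab
        simp only [List.mem_filter, decide_eq_true_eq] at ha hb
        -- same level and same index
        apply ofLex.injective
        have h1 : (ofLex a).1 = (ofLex b).1 := Fin.ext (ha.2.trans hb.2.symm)
        exact Sigma.ext h1 ((Fin.heq_ext_iff (by rw [h1])).2 hab)
      have hlmem : ∀ j, j ∈ l ↔ j < r s' := by
        intro j
        simp only [hl, List.mem_map, List.mem_filter, hF, Finset.mem_sort, Finset.mem_univ,
          true_and, decide_eq_true_eq]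
        constructor
        · rintro ⟨a, ha, rfl⟩
          have h1 : (ofLex a).1 = s' := Fin.ext ha
          have key : ∀ (q : Σ s : Fin L, Fin (r s)), q.1 = s' → ((q.2 : ℕ)) < r s' := by
            rintro ⟨q1, q2⟩ hq
            simp only at hq
            subst hq
            exact q2.2
          exact key (ofLex a) h1
        · intro hj
          refine ⟨toLex ⟨s', ⟨j, hj⟩⟩, ?_, ?_⟩
          · simp [lvl, hs']
          · simp
      obtain ⟨z, hz, hxz⟩ := hml l hlnodup hlmem
      obtain ⟨ez, hez, hez0, hzeq⟩ := ih (s + 1) (by omega) z hz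
      -- the exponent vector
      let ex : ι → ℕ := fun a => ez a + if lvl a = s then m ((ofLex a).2 : ℕ) else 0
      have hexs : ∀ a, lvl a = s → ex a = m ((ofLex a).2 : ℕ) := by
        intro a ha
        simp only [ex, if_pos ha, hez0 a (by omega), zero_add]
      have hexo : ∀ a, lvl a ≠ s → ex a = ez a := by
        intro a ha
        simp only [ex, if_neg ha, add_zero]
      refine ⟨ex, fun a => ?_, fun a ha => ?_, ?_⟩
      · by_cases h : lvl a = s
        · rw [hexs a h]; exact hm _
        · rw [hexo a h]; exact hez a
      · rw [hexo a (by omega)]; exact hez0 a (by omega)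
      -- the product
      have hsplit := fun (e' : ι → ℕ) => prod_map_split lvl lvl_mono (fun a => gen a ^ e' a) s F
        (Finset.pairwise_sort _ _)
      have hPex : orderedProd gen ex = ((F.filter fun a => lvl a = s).map fun a => gen a ^ ex a).prod *
          ((F.filter fun a => s < lvl a).map fun a => gen a ^ ez a).prod := by
        rw [orderedProd, ← hF, hsplit ex, prod_map_pow_eq_one, one_mul]
        · congr 1
          refine congrArg _ (List.map_congr_left fun a ha => ?_)
          simp only [List.mem_filter, decide_eq_true_eq] at ha
          rw [hexo a (by omega)]
        · intro a ha
          simp only [List.mem_filter, decide_eq_true_eq] at ha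
          rw [hexo a (by omega)]
          exact hez0 a (by omega)
      have hPez : orderedProd gen ez = ((F.filter fun a => s < lvl a).map fun a => gen a ^ ez a).prod := by
        rw [orderedProd, ← hF, hsplit ez, prod_map_pow_eq_one, one_mul, prod_map_pow_eq_one, one_mul]
        · intro a ha
          simp only [List.mem_filter, decide_eq_true_eq] at ha
          exact hez0 a (by omega)
        · intro a ha
          simp only [List.mem_filter, decide_eq_true_eq] at ha
          exact hez0 a (by omega)
      have hmid : ((F.filter fun a => lvl a = s).map fun a => gen a ^ ex a).prod =
          (l.map fun j => g s' j ^ m j).prod := by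
        rw [hl, List.map_map]
        refine congrArg _ (List.map_congr_left fun a ha => ?_)
        simp only [List.mem_filter, decide_eq_true_eq] at ha
        have h1 : (ofLex a).1 = s' := Fin.ext ha.2
        simp only [Function.comp_apply, gen, hexs a ha.2, h1]
      rw [hPex, hmid, ← hPez, ← hzeq]
      exact hxz
  -- packaging
  have hrep' : ∀ s ≤ L, ∀ x ∈ H s, ∃ ex : ι → ℕ, (∀ a, ex a < p) ∧
      (∀ a, lvl a < s → ex a = 0) ∧ x = orderedProd gen ex :=
    fun s hs x hx => hrep (L - s) s (by omega) x hx
  -- commutators and powers of generators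
  have hcommH : ∀ a b : ι, ⁅gen a, gen b⁆ ∈ H (max (lvl a) (lvl b) + 1) := by
    intro a b
    have ha : ⁅gen a, gen b⁆ ∈ H (lvl a + 1) :=
      Hcomm _ (Subgroup.commutator_mem_commutator (gen_mem a) (Subgroup.mem_top _))
    have hb : ⁅gen a, gen b⁆ ∈ H (lvl b + 1) := by
      rw [← commutatorElement_inv]
      exact inv_mem (Hcomm _ (Subgroup.commutator_mem_commutator (gen_mem b) (Subgroup.mem_top _)))
    rcases le_total (lvl a) (lvl b) with h | h
    · rw [max_eq_right h]; exact hb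
    · rw [max_eq_left h]; exact ha
  have hmaxL : ∀ a b : ι, max (lvl a) (lvl b) + 1 ≤ L := fun a b =>
    Nat.succ_le_of_lt (max_lt (lvl_lt a) (lvl_lt b))
  choose commExp hcommExp_lt hcommExp_lvl hcommExp_prod using
    fun a b : ι => hrep' _ (hmaxL a b) _ (hcommH a b)
  choose powExp hpowExp_lt hpowExp_lvl hpowExp_prod using
    fun a : ι => hrep' _ (Nat.succ_le_of_lt (lvl_lt a)) _ (Hpow _ _ (gen_mem a))
  -- cardinality
  have hcardH : ∀ d s, s + d = L →
      Nat.card (H s) = p ^ (∑ t ∈ Finset.univ.filter (fun t : Fin L => s ≤ (t : ℕ)), r t) := by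
    intro d
    induction d with
    | zero =>
      intro s hs
      rw [Nat.add_zero] at hs
      subst hs
      rw [HL, Subgroup.card_bot]
      have : (Finset.univ.filter fun t : Fin L => L ≤ (t : ℕ)) = ∅ := by
        ext t; simp [Nat.not_le.2 t.2]
      rw [this, Finset.sum_empty, pow_zero]
    | succ d ih =>
      intro s hs
      have hsL : s < L := by omega
      rw [hcard ⟨s, hsL⟩, ih (s + 1) (by omega), ← pow_add]
      congr 1
      have : (Finset.univ.filter fun t : Fin L => s ≤ (t : ℕ)) =
          insert ⟨s, hsL⟩ (Finset.univ.filter fun t : Fin L => s + 1 ≤ (t : ℕ)) := by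
        ext t
        simp only [Finset.mem_filter, Finset.mem_univ, true_and, Finset.mem_insert, Fin.ext_iff]
        omega
      rw [this, Finset.sum_insert]
      simp
  have hcardS : Nat.card S = p ^ Fintype.card ι := by
    rw [← Subgroup.card_top (G := S), ← H0, hcardH L 0 (by omega)]
    congr 1
    rw [Fintype.card_lex, Fintype.card_sigma]
    simp only [Fintype.card_fin]
    refine Finset.sum_congr ?_ fun _ _ => rfl
    ext t; simp
  refine ⟨ι, inferInstance, inferInstance,
    { L := L
      lvl := lvl
      gen := gen
      commExp := commExp
      powExp := powExp
      lvl_lt := lvl_lt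
      lvl_mono := lvl_mono
      commExp_lt := fun a b c => hcommExp_lt a b c
      commExp_lvl := fun a b c hc => by
        by_contra hcon
        exact hc (hcommExp_lvl a b c (by omega))
      commExp_prod := fun a b => hcommExp_prod a b
      powExp_lt := fun a c => hpowExp_lt a c
      powExp_lvl := fun a c hc => by
        by_contra hcon
        exact hc (hpowExp_lvl a c (by omega))
      powExp_prod := fun a => hpowExp_prod a
      exists_exp := fun x => by
        obtain ⟨ex, h1, -, h2⟩ := hrep' 0 (Nat.zero_le _) x (by rw [H0]; exact Subgroup.mem_top x)
        exact ⟨ex, h1, h2⟩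
      card_eq := hcardS }, rfl⟩

end Assembly




end Literature.Barriers.MatrixMultiplication

end
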